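import Summits.AtomisticToContinuum.HydrodynamicLimit.Theorems.AntiMazurCoboundariesCorrectorPressureDecayKiferEntropyLsc
import Mathlib.MeasureTheory.Integral.Pi

/-!
# Entropy bound for tangent states, VI: superadditivity of the relative entropy over independent blocks (line `FirstLemma`, crux stmt-AtomisticToContinuum-14135)

Helper file (step (F-a), "Shearer for a product reference over a disjoint partition") of the registered stub
`stub_tangentEntropyBoundUniform : TangentEntropyBoundUniform` (`…KiferEntropyBoundAffinity.lean`), namespace
`Summit.AtomisticToContinuum.HydrodynamicLimit.Theorems.KiferCompactification`.

The finite-`N` cell inequality behind the unit-weight entropy bound ("`H(Q_N | G_N) ≤ κ N` passes to local-equilibrium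
limit points with constant `1`") tiles the torus by `m = M³` disjoint translates `W_1, …, W_m` of the microscopic window and
needs, for a reference law `P` under which the configurations seen in DISJOINT windows are INDEPENDENT (Poisson / ideal gas,
or the canonical law after its change of reference), the SUPERADDITIVITY of the Kullback–Leibler divergence over the blocks:
`∑ⱼ KL(Q_{W_j} ‖ P_{W_j}) ≤ KL(Q ‖ P)` for EVERY probability law `Q`. This file proves it on general measurable spaces,
with no Radon–Nikodym or disintegration bookkeeping, from the two halves of the Donsker–Varadhan variational formula in the
tree (`Literature.Probability.Divergences.integral_le_toReal_klDiv_add_log`, `klDiv_le_of_forall_integral_le`):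

* `klDiv_map_fst_add_klDiv_map_snd_le` — two blocks, product reference:
  `KL(Q₁ ‖ P₁) + KL(Q₂ ‖ P₂) ≤ KL(Q ‖ P₁ ⊗ P₂)` for a probability law `Q` on `α × β` with marginals `Q₁, Q₂`;
* `sum_klDiv_map_eval_le_klDiv_pi` — finitely many blocks, product reference `Measure.pi P`:
  `∑ᵢ KL(Q.map (eval i) ‖ P i) ≤ KL(Q ‖ ⨂ᵢ P i)`;
* `klDiv_map_add_klDiv_map_le_of_map_prod` and `sum_klDiv_map_le_klDiv_of_map_pi` — the same for block maps
  `f i : Ω → E i` out of a common space which are independent under the reference `P`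
  (`P.map (ω ↦ (f i ω)ᵢ) = ⨂ᵢ P.map (f i)`), combined with the data-processing inequality `klDiv_map_le_klDiv`
  (`…KiferEntropyLsc.lean`): `∑ᵢ KL(Q.map (f i) ‖ P.map (f i)) ≤ KL(Q ‖ P)`.

Proof (two blocks; the finite case is the same induction over the blocks): the joint Gibbs inequality tested on
`ψ₁ ⊕ ψ₂` reads `F₁(ψ₁) + F₂(ψ₂) ≤ KL(Q ‖ P₁ ⊗ P₂)` with `Fᵢ(ψ) = ∫ ψ dQᵢ - log ∫ e^ψ dPᵢ` (the exponential moment of a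
sum of functions of independent coordinates factorises); the Donsker–Varadhan upper bound in `ψ₁` gives
`KL(Q₁ ‖ P₁) ≤ KL - F₂(ψ₂)` for every `ψ₂`, and then in `ψ₂` gives `KL(Q₂ ‖ P₂) ≤ KL - KL(Q₁ ‖ P₁)`.
References: fractional super-additivity of the relative entropy w.r.t. product measures (Madiman–Tetali 2010, §V;
Kipnis–Landim 1999, App. 1 §8 for the variational formula); Olla–Varadhan–Yau 1993, proof of Lemma 4.2 (tiling step).
-/

noncomputable section

open MeasureTheory Set Filter Topology InformationTheory
open scoped ENNReal

namespace Summit.AtomisticToContinuum.HydrodynamicLimit.Theorems.KiferCompactification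

open Literature.Probability.Divergences (integral_le_toReal_klDiv_add_log klDiv_le_of_forall_integral_le)

section Bounded

variable {Ω : Type*} [MeasurableSpace Ω]

/-- A measurable function bounded by `C` is integrable under a finite measure. -/
private theorem integrable_of_abs_le_const (μ : Measure Ω) [IsFiniteMeasure μ] {ψ : Ω → ℝ} (hψ : Measurable ψ)
    {C : ℝ} (hC : ∀ x, |ψ x| ≤ C) : Integrable ψ μ :=
  Integrable.of_bound hψ.aestronglyMeasurable C (ae_of_all _ fun x => by rw [Real.norm_eq_abs]; exact hC x)

/-- The exponential of a measurable function bounded by `C` is integrable under a finite measure. -/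
private theorem integrable_exp_of_abs_le_const (μ : Measure Ω) [IsFiniteMeasure μ] {ψ : Ω → ℝ} (hψ : Measurable ψ)
    {C : ℝ} (hC : ∀ x, |ψ x| ≤ C) : Integrable (fun x => Real.exp (ψ x)) μ :=
  Integrable.of_bound hψ.exp.aestronglyMeasurable (Real.exp C) (ae_of_all _ fun x => by
    rw [Real.norm_eq_abs, abs_of_pos (Real.exp_pos _)]
    exact Real.exp_le_exp.2 ((le_abs_self _).trans (hC x)))

/-- The exponential moment of a bounded measurable function under a probability law is positive. -/
private theorem integral_exp_pos_of_abs_le_const (μ : Measure Ω) [IsProbabilityMeasure μ] {ψ : Ω → ℝ}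
    (hψ : Measurable ψ) {C : ℝ} (hC : ∀ x, |ψ x| ≤ C) : 0 < ∫ x, Real.exp (ψ x) ∂μ :=
  integral_exp_pos (integrable_exp_of_abs_le_const μ hψ hC)

/-- The zero test function has exponential moment `1`. -/
private theorem integral_exp_zero_eq_one (μ : Measure Ω) [IsProbabilityMeasure μ] :
    ∫ _x, Real.exp ((fun _ : Ω => (0 : ℝ)) _x) ∂μ = 1 := by
  simp

end Bounded

/-! ## Two blocks -/

section Two

/-- **Superadditivity of the relative entropy over two independent blocks.** For a probability law `Q` on `α × β`
with marginals `Q₁ = Q.map fst`, `Q₂ = Q.map snd` and probability laws `P₁, P₂`: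
`KL(Q₁ ‖ P₁) + KL(Q₂ ‖ P₂) ≤ KL(Q ‖ P₁ ⊗ P₂)` (the mutual information of `Q` is the nonnegative defect). -/
theorem klDiv_map_fst_add_klDiv_map_snd_le {α β : Type*} [MeasurableSpace α] [MeasurableSpace β]
    (Q : Measure (α × β)) [IsProbabilityMeasure Q] (P₁ : Measure α) [IsProbabilityMeasure P₁] (P₂ : Measure β)
    [IsProbabilityMeasure P₂] :
    klDiv (Q.map Prod.fst) P₁ + klDiv (Q.map Prod.snd) P₂ ≤ klDiv Q (P₁.prod P₂) := by
  by_cases hfin : klDiv Q (P₁.prod P₂) = ∞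
  · rw [hfin]; exact le_top
  haveI : IsProbabilityMeasure (Q.map Prod.fst) := Measure.isProbabilityMeasure_map measurable_fst.aemeasurable
  haveI : IsProbabilityMeasure (Q.map Prod.snd) := Measure.isProbabilityMeasure_map measurable_snd.aemeasurable
  set k : ℝ := (klDiv Q (P₁.prod P₂)).toReal with hk
  -- the joint Gibbs inequality tested on `ψ₁ ⊕ ψ₂`
  have hjoint : ∀ (ψ₁ : α → ℝ) (C₁ : ℝ) (ψ₂ : β → ℝ) (C₂ : ℝ), Measurable ψ₁ → (∀ x, |ψ₁ x| ≤ C₁) →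
      Measurable ψ₂ → (∀ y, |ψ₂ y| ≤ C₂) →
      (∫ x, ψ₁ x ∂(Q.map Prod.fst)) + ∫ y, ψ₂ y ∂(Q.map Prod.snd) ≤
        k + Real.log (∫ x, Real.exp (ψ₁ x) ∂P₁) + Real.log (∫ y, Real.exp (ψ₂ y) ∂P₂) := by
    intro ψ₁ C₁ ψ₂ C₂ hψ₁ hC₁ hψ₂ hC₂
    have hΨm : Measurable fun p : α × β => ψ₁ p.1 + ψ₂ p.2 :=
      (hψ₁.comp measurable_fst).add (hψ₂.comp measurable_snd)
    have hΨb : ∀ p : α × β, |ψ₁ p.1 + ψ₂ p.2| ≤ C₁ + C₂ := fun p =>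
      (abs_add_le _ _).trans (add_le_add (hC₁ _) (hC₂ _))
    have h := integral_le_toReal_klDiv_add_log hfin hΨm hΨb
    have hsum : ∫ p, (ψ₁ p.1 + ψ₂ p.2) ∂Q = (∫ x, ψ₁ x ∂(Q.map Prod.fst)) + ∫ y, ψ₂ y ∂(Q.map Prod.snd) := by
      rw [integral_add (integrable_of_abs_le_const Q (ψ := fun p : α × β => ψ₁ p.1) (hψ₁.comp measurable_fst)
          fun p => hC₁ p.1)
        (integrable_of_abs_le_const Q (ψ := fun p : α × β => ψ₂ p.2) (hψ₂.comp measurable_snd) fun p => hC₂ p.2),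
        integral_map measurable_fst.aemeasurable hψ₁.aestronglyMeasurable,
        integral_map measurable_snd.aemeasurable hψ₂.aestronglyMeasurable]
    have hprod : ∫ p, Real.exp (ψ₁ p.1 + ψ₂ p.2) ∂(P₁.prod P₂) =
        (∫ x, Real.exp (ψ₁ x) ∂P₁) * ∫ y, Real.exp (ψ₂ y) ∂P₂ := by
      simp_rw [Real.exp_add]
      exact integral_prod_mul (fun x => Real.exp (ψ₁ x)) fun y => Real.exp (ψ₂ y)
    rw [hsum, hprod, Real.log_mul (integral_exp_pos_of_abs_le_const P₁ hψ₁ hC₁).ne'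
      (integral_exp_pos_of_abs_le_const P₂ hψ₂ hC₂).ne'] at h
    linarith
  -- first block
  have h1 : klDiv (Q.map Prod.fst) P₁ ≤ ENNReal.ofReal k := by
    refine klDiv_le_of_forall_integral_le fun ψ C hψ hC => ?_
    have h := hjoint ψ C (fun _ => 0) 0 hψ hC measurable_const (fun _ => by simp)
    rw [integral_exp_zero_eq_one P₂, Real.log_one, add_zero, integral_zero, add_zero] at h
    exact h
  have h1fin : klDiv (Q.map Prod.fst) P₁ ≠ ∞ := ne_top_of_le_ne_top ENNReal.ofReal_ne_top h1
  set k₁ : ℝ := (klDiv (Q.map Prod.fst) P₁).toReal with hk₁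
  have hk₁k : k₁ ≤ k := by
    have h := ENNReal.toReal_mono ENNReal.ofReal_ne_top h1
    rwa [ENNReal.toReal_ofReal ENNReal.toReal_nonneg] at h
  -- second block
  have h2 : klDiv (Q.map Prod.snd) P₂ ≤ ENNReal.ofReal (k - k₁) := by
    refine klDiv_le_of_forall_integral_le fun ψ₂ C₂ hψ₂ hC₂ => ?_
    set F₂ : ℝ := (∫ y, ψ₂ y ∂(Q.map Prod.snd)) - Real.log (∫ y, Real.exp (ψ₂ y) ∂P₂) with hF₂
    have hK : klDiv (Q.map Prod.fst) P₁ ≤ ENNReal.ofReal (k - F₂) := by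
      refine klDiv_le_of_forall_integral_le fun ψ₁ C₁ hψ₁ hC₁ => ?_
      have h := hjoint ψ₁ C₁ ψ₂ C₂ hψ₁ hC₁ hψ₂ hC₂
      rw [hF₂]
      linarith
    have hnn : 0 ≤ k - F₂ := by
      have h := hjoint (fun _ => 0) 0 ψ₂ C₂ measurable_const (fun _ => by simp) hψ₂ hC₂
      rw [integral_exp_zero_eq_one P₁, Real.log_one, add_zero, integral_zero, zero_add] at h
      rw [hF₂]
      linarith
    have h := ENNReal.toReal_mono ENNReal.ofReal_ne_top hK
    rw [ENNReal.toReal_ofReal hnn, ← hk₁, hF₂] at h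
    linarith
  -- combine
  calc klDiv (Q.map Prod.fst) P₁ + klDiv (Q.map Prod.snd) P₂
      ≤ ENNReal.ofReal k₁ + ENNReal.ofReal (k - k₁) := add_le_add (ENNReal.ofReal_toReal h1fin).ge h2
    _ = ENNReal.ofReal k := by
        rw [← ENNReal.ofReal_add ENNReal.toReal_nonneg (sub_nonneg.2 hk₁k), add_sub_cancel]
    _ = klDiv Q (P₁.prod P₂) := ENNReal.ofReal_toReal hfin

/-- **Superadditivity over two block maps which are independent under the reference.** For probability laws `Q, P`
on `Ω` and measurable `f : Ω → α`, `g : Ω → β` with `P.map (f, g) = P.map f ⊗ P.map g`: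
`KL(Q.map f ‖ P.map f) + KL(Q.map g ‖ P.map g) ≤ KL(Q ‖ P)` (two blocks after data processing along `(f, g)`). -/
theorem klDiv_map_add_klDiv_map_le_of_map_prod {α β : Type*} [MeasurableSpace α] [MeasurableSpace β]
    {Ω : Type*} [MeasurableSpace Ω] (Q P : Measure Ω) [IsProbabilityMeasure Q] [IsProbabilityMeasure P]
    {f : Ω → α} {g : Ω → β} (hf : Measurable f) (hg : Measurable g)
    (hind : P.map (fun ω => (f ω, g ω)) = (P.map f).prod (P.map g)) :
    klDiv (Q.map f) (P.map f) + klDiv (Q.map g) (P.map g) ≤ klDiv Q P := by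
  have hfg : Measurable fun ω => (f ω, g ω) := hf.prodMk hg
  haveI : IsProbabilityMeasure (P.map f) := Measure.isProbabilityMeasure_map hf.aemeasurable
  haveI : IsProbabilityMeasure (P.map g) := Measure.isProbabilityMeasure_map hg.aemeasurable
  haveI : IsProbabilityMeasure (Q.map fun ω => (f ω, g ω)) := Measure.isProbabilityMeasure_map hfg.aemeasurable
  have h1 : (Q.map fun ω => (f ω, g ω)).map Prod.fst = Q.map f := by
    rw [Measure.map_map measurable_fst hfg]; rfl
  have h2 : (Q.map fun ω => (f ω, g ω)).map Prod.snd = Q.map g := by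
    rw [Measure.map_map measurable_snd hfg]; rfl
  calc klDiv (Q.map f) (P.map f) + klDiv (Q.map g) (P.map g)
      = klDiv ((Q.map fun ω => (f ω, g ω)).map Prod.fst) (P.map f) +
          klDiv ((Q.map fun ω => (f ω, g ω)).map Prod.snd) (P.map g) := by rw [h1, h2]
    _ ≤ klDiv (Q.map fun ω => (f ω, g ω)) ((P.map f).prod (P.map g)) :=
        klDiv_map_fst_add_klDiv_map_snd_le _ _ _
    _ = klDiv (Q.map fun ω => (f ω, g ω)) (P.map fun ω => (f ω, g ω)) := by rw [hind]
    _ ≤ klDiv Q P := klDiv_map_le_klDiv Q P hfg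

end Two

/-! ## Finitely many blocks -/

section Pi

/-- **Superadditivity of the relative entropy over finitely many independent blocks.** For a probability law `Q` on
`Π i, E i` and probability laws `P i` on the blocks: `∑ᵢ KL(Q.map (eval i) ‖ P i) ≤ KL(Q ‖ ⨂ᵢ P i)`. Induction over
the blocks: if `k = KL(Q ‖ ⨂ P i) < ∞`, then for every finite set `s` of blocks already treated and every bounded
measurable family `ψ`, `∑_{i ∈ s} KL(Qᵢ ‖ Pᵢ) + ∑_{i ∉ s} (∫ ψᵢ dQᵢ - log ∫ e^{ψᵢ} dPᵢ) ≤ k` (`s = ∅` is the joint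
Gibbs inequality tested on `⊕ᵢ ψᵢ`; the step is the Donsker–Varadhan upper bound in the new block). -/
theorem sum_klDiv_map_eval_le_klDiv_pi {ι : Type*} [Fintype ι] {E : ι → Type*} [∀ i, MeasurableSpace (E i)]
    (Q : Measure (∀ i, E i)) [IsProbabilityMeasure Q] (P : ∀ i, Measure (E i)) [∀ i, IsProbabilityMeasure (P i)] :
    ∑ i, klDiv (Q.map (Function.eval i)) (P i) ≤ klDiv Q (Measure.pi P) := by
  classical
  by_cases hfin : klDiv Q (Measure.pi P) = ∞
  · rw [hfin]; exact le_top
  haveI hQi : ∀ i, IsProbabilityMeasure (Q.map (Function.eval i)) := fun i =>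
    Measure.isProbabilityMeasure_map (measurable_pi_apply i).aemeasurable
  set k : ℝ := (klDiv Q (Measure.pi P)).toReal with hk
  -- the block functionals `F i ψ = ∫ ψ i dQ_i - log ∫ e^{ψ i} dP_i`
  set F : ι → (∀ i, E i → ℝ) → ℝ := fun i ψ =>
    (∫ x, ψ i x ∂(Q.map (Function.eval i))) - Real.log (∫ x, Real.exp (ψ i x) ∂(P i)) with hF
  -- the joint Gibbs inequality tested on `⊕ᵢ ψᵢ`
  have hjoint : ∀ (ψ : ∀ i, E i → ℝ) (C : ι → ℝ), (∀ i, Measurable (ψ i)) → (∀ i x, |ψ i x| ≤ C i) →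
      ∑ i, F i ψ ≤ k := by
    intro ψ C hψ hC
    have hΨm : Measurable fun p : ∀ i, E i => ∑ i, ψ i (p i) :=
      Finset.measurable_sum _ fun i _ => (hψ i).comp (measurable_pi_apply i)
    have hΨb : ∀ p : ∀ i, E i, |∑ i, ψ i (p i)| ≤ ∑ i, C i := fun p =>
      (Finset.abs_sum_le_sum_abs _ _).trans (Finset.sum_le_sum fun i _ => hC i (p i))
    have h := integral_le_toReal_klDiv_add_log hfin hΨm hΨb
    have hsum : ∫ p, (∑ i, ψ i (p i)) ∂Q = ∑ i, ∫ x, ψ i x ∂(Q.map (Function.eval i)) := by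
      rw [integral_finsetSum _ fun i _ => integrable_of_abs_le_const Q (ψ := fun p : ∀ i, E i => ψ i (p i))
        ((hψ i).comp (measurable_pi_apply i)) fun p => hC i (p i)]
      refine Finset.sum_congr rfl fun i _ => ?_
      rw [integral_map (measurable_pi_apply i).aemeasurable (hψ i).aestronglyMeasurable]
    have hprod : ∫ p, Real.exp (∑ i, ψ i (p i)) ∂(Measure.pi P) = ∏ i, ∫ x, Real.exp (ψ i x) ∂(P i) := by
      simp_rw [Real.exp_sum]
      exact integral_fintype_prod_eq_prod (fun i x => Real.exp (ψ i x))
    rw [hsum, hprod, Real.log_prod (s := Finset.univ) (f := fun i => ∫ x, Real.exp (ψ i x) ∂(P i))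
      (fun i _ => (integral_exp_pos_of_abs_le_const (P i) (hψ i) (hC i)).ne')] at h
    have hrw : ∑ i, F i ψ = (∑ i, ∫ x, ψ i x ∂(Q.map (Function.eval i))) -
        ∑ i, Real.log (∫ x, Real.exp (ψ i x) ∂(P i)) := by
      rw [hF, ← Finset.sum_sub_distrib]
    rw [hrw]
    linarith
  -- induction over the treated blocks
  have hclaim : ∀ s : Finset ι, (∀ i ∈ s, klDiv (Q.map (Function.eval i)) (P i) ≠ ∞) ∧
      ∀ (ψ : ∀ i, E i → ℝ) (C : ι → ℝ), (∀ i, Measurable (ψ i)) → (∀ i x, |ψ i x| ≤ C i) →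
        (∑ i ∈ s, (klDiv (Q.map (Function.eval i)) (P i)).toReal) + ∑ i ∈ sᶜ, F i ψ ≤ k := by
    intro s
    induction s using Finset.induction_on with
    | empty =>
        refine ⟨fun i hi => absurd hi (Finset.notMem_empty i), fun ψ C hψ hC => ?_⟩
        rw [Finset.sum_empty, zero_add, Finset.compl_empty]
        exact hjoint ψ C hψ hC
    | @insert j s hj ih =>
        obtain ⟨ihfin, ihb⟩ := ih
        -- the complement splits off the new block `j`
        have hjc : j ∈ sᶜ := Finset.mem_compl.2 hj
        have hsplit : ∀ G : ι → ℝ, ∑ i ∈ sᶜ, G i = G j + ∑ i ∈ (insert j s)ᶜ, G i := by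
          intro G
          rw [Finset.compl_insert, ← Finset.sum_insert (Finset.notMem_erase j sᶜ), Finset.insert_erase hjc]
        -- Donsker–Varadhan in the block `j`, the other test functions being frozen
        have hDV : ∀ (ψ : ∀ i, E i → ℝ) (C : ι → ℝ), (∀ i, Measurable (ψ i)) → (∀ i x, |ψ i x| ≤ C i) →
            klDiv (Q.map (Function.eval j)) (P j) ≤ ENNReal.ofReal
              (k - (∑ i ∈ s, (klDiv (Q.map (Function.eval i)) (P i)).toReal) - ∑ i ∈ (insert j s)ᶜ, F i ψ) ∧
            0 ≤ k - (∑ i ∈ s, (klDiv (Q.map (Function.eval i)) (P i)).toReal) - ∑ i ∈ (insert j s)ᶜ, F i ψ := by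
          intro ψ C hψ hC
          -- freezing: updating the block `j` does not change the other functionals
          have hfreeze : ∀ (φ : E j → ℝ), ∑ i ∈ (insert j s)ᶜ, F i (Function.update ψ j φ) =
              ∑ i ∈ (insert j s)ᶜ, F i ψ := by
            intro φ
            refine Finset.sum_congr rfl fun i hi => ?_
            have hij : i ≠ j := by
              rintro rfl
              rw [Finset.compl_insert] at hi
              exact Finset.notMem_erase i sᶜ hi
            simp only [hF, Function.update_of_ne hij]
          have hnew : ∀ (φ : E j → ℝ), F j (Function.update ψ j φ) =
              (∫ x, φ x ∂(Q.map (Function.eval j))) - Real.log (∫ x, Real.exp (φ x) ∂(P j)) := by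
            intro φ
            simp only [hF, Function.update_self]
          -- the frozen inequality for an arbitrary test function in the block `j`
          have hkey : ∀ (φ : E j → ℝ) (Cφ : ℝ), Measurable φ → (∀ x, |φ x| ≤ Cφ) →
              (∫ x, φ x ∂(Q.map (Function.eval j))) - Real.log (∫ x, Real.exp (φ x) ∂(P j)) ≤
                k - (∑ i ∈ s, (klDiv (Q.map (Function.eval i)) (P i)).toReal) - ∑ i ∈ (insert j s)ᶜ, F i ψ := by
            intro φ Cφ hφ hCφ
            have hψ' : ∀ i, Measurable (Function.update ψ j φ i) := by
              intro i
              by_cases hij : i = j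
              · subst hij; rw [Function.update_self]; exact hφ
              · rw [Function.update_of_ne hij]; exact hψ i
            have hC' : ∀ i x, |Function.update ψ j φ i x| ≤ Function.update C j Cφ i := by
              intro i x
              by_cases hij : i = j
              · subst hij; rw [Function.update_self, Function.update_self]; exact hCφ x
              · rw [Function.update_of_ne hij, Function.update_of_ne hij]; exact hC i x
            have h := ihb (Function.update ψ j φ) (Function.update C j Cφ) hψ' hC'
            rw [hsplit (fun i => F i (Function.update ψ j φ)), hfreeze φ, hnew φ] at h
            linarith
          refine ⟨klDiv_le_of_forall_integral_le fun φ Cφ hφ hCφ => ?_, ?_⟩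
          · have h := hkey φ Cφ hφ hCφ
            linarith
          · have h := hkey (fun _ => 0) 0 measurable_const (fun _ => by simp)
            rw [integral_exp_zero_eq_one (P j), Real.log_one, sub_zero, integral_zero] at h
            exact h
        have hjfin : klDiv (Q.map (Function.eval j)) (P j) ≠ ∞ :=
          ne_top_of_le_ne_top ENNReal.ofReal_ne_top
            (hDV (fun _ _ => 0) (fun _ => 0) (fun _ => measurable_const) (fun _ _ => by simp)).1
        refine ⟨fun i hi => ?_, fun ψ C hψ hC => ?_⟩
        · rcases Finset.mem_insert.1 hi with rfl | hi
          · exact hjfin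
          · exact ihfin i hi
        · obtain ⟨hle, hnn⟩ := hDV ψ C hψ hC
          have h := ENNReal.toReal_mono ENNReal.ofReal_ne_top hle
          rw [ENNReal.toReal_ofReal hnn] at h
          rw [Finset.sum_insert hj]
          linarith
  -- all blocks treated
  obtain ⟨hallfin, hall⟩ := hclaim Finset.univ
  have hsumle : ∑ i, (klDiv (Q.map (Function.eval i)) (P i)).toReal ≤ k := by
    have h := hall (fun _ _ => 0) (fun _ => 0) (fun _ => measurable_const) (fun _ _ => by simp)
    rwa [Finset.compl_univ, Finset.sum_empty, add_zero] at h
  calc ∑ i, klDiv (Q.map (Function.eval i)) (P i)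
      = ∑ i, ENNReal.ofReal ((klDiv (Q.map (Function.eval i)) (P i)).toReal) :=
        Finset.sum_congr rfl fun i _ => (ENNReal.ofReal_toReal (hallfin i (Finset.mem_univ i))).symm
    _ = ENNReal.ofReal (∑ i, (klDiv (Q.map (Function.eval i)) (P i)).toReal) :=
        (ENNReal.ofReal_sum_of_nonneg fun i _ => ENNReal.toReal_nonneg).symm
    _ ≤ ENNReal.ofReal k := ENNReal.ofReal_le_ofReal hsumle
    _ = klDiv Q (Measure.pi P) := ENNReal.ofReal_toReal hfin

/-- **Superadditivity over finitely many block maps which are independent under the reference** (the form used on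
disjoint windows of a configuration, whose restrictions are independent under a Poisson reference). For probability
laws `Q, P` on `Ω` and measurable `f i : Ω → E i` with `P.map (ω ↦ (f i ω)ᵢ) = ⨂ᵢ P.map (f i)`:
`∑ᵢ KL(Q.map (f i) ‖ P.map (f i)) ≤ KL(Q ‖ P)`. -/
theorem sum_klDiv_map_le_klDiv_of_map_pi {ι : Type*} [Fintype ι] {E : ι → Type*} [∀ i, MeasurableSpace (E i)]
    {Ω : Type*} [MeasurableSpace Ω] (Q P : Measure Ω) [IsProbabilityMeasure Q] [IsProbabilityMeasure P]
    {f : ∀ i, Ω → E i} (hf : ∀ i, Measurable (f i))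
    (hind : P.map (fun ω i => f i ω) = Measure.pi fun i => P.map (f i)) :
    ∑ i, klDiv (Q.map (f i)) (P.map (f i)) ≤ klDiv Q P := by
  have hF : Measurable fun (ω : Ω) (i : ι) => f i ω := measurable_pi_lambda _ hf
  haveI : ∀ i, IsProbabilityMeasure (P.map (f i)) := fun i => Measure.isProbabilityMeasure_map (hf i).aemeasurable
  haveI : IsProbabilityMeasure (Q.map fun ω i => f i ω) := Measure.isProbabilityMeasure_map hF.aemeasurable
  have hi : ∀ i, (Q.map fun ω i => f i ω).map (Function.eval i) = Q.map (f i) := by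
    intro i
    rw [Measure.map_map (measurable_pi_apply i) hF]
    rfl
  calc ∑ i, klDiv (Q.map (f i)) (P.map (f i))
      = ∑ i, klDiv ((Q.map fun ω i => f i ω).map (Function.eval i)) (P.map (f i)) :=
        Finset.sum_congr rfl fun i _ => by rw [hi i]
    _ ≤ klDiv (Q.map fun ω i => f i ω) (Measure.pi fun i => P.map (f i)) :=
        sum_klDiv_map_eval_le_klDiv_pi _ _
    _ = klDiv (Q.map fun ω i => f i ω) (P.map fun ω i => f i ω) := by rw [hind]
    _ ≤ klDiv Q P := klDiv_map_le_klDiv Q P hF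

end Pi

end Summit.AtomisticToContinuum.HydrodynamicLimit.Theorems.KiferCompactification

end
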